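import Mathlib
import Literature.MathematicalPhysics.QuantumLattice.ThinSectorFoldCriticalWindow
import HarnessLib

/-!
# Four-sector counting, fold ranges: slope and chain bounds of the diagonal function on the convex window of a minimum

Topic `Literature/MathematicalPhysics/QuantumLattice`; sub-namespace `BandSectorCounting` (generic one-variable calculus, continues
`ThinSectorFoldCriticalWindow`).  Part (F3c-i) of the log-free ANISOTROPIC anchored four-sector counting lemma («E1-P2-THIN-COUNT», cell
gate-hubbard-kl, plan g17 (R41); seat p4; plan HOME/prover-p4/E1-P2-THIN-COUNT-PLAN.md §Refinement 4).  On the window `[σ_c − R, σ_c + R]` of a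
critical point `σ_c` of the diagonal function `D` with `D″ ≥ c₂ > 0` (the stratum of `diag_strat`, BGM App. A2), the umklapp-corner rows whose
anti-diagonal fibre crosses the level have `D < 0`; the arcsine row sum (`ThinSectorFoldArcsineSum`) needs, besides `le_of_critical`, the
TANGENT inequality of the convex `D`: a SHALLOW negative point (`D(σ_c)/2 < D(x) ≤ 0`) has `|x − σ_c| ≤ √(2|D(σ_c)|/c₂)` and slope
`|D′(x)| ≥ |D(σ_c)|/(2|x − σ_c|) ≥ √(c₂|D(σ_c)|/8)`, so along a chain of shallow points `|D|` grows at rate `≥ √(c₂|D(σ_c)|/8)`: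

* `sq_sub_le_of_nonpos_near_min`, `deriv_ge_of_shallow_right` / `deriv_le_of_shallow_left`, `mono_right_of_min` / `anti_left_of_min`,
  **`chain_right`** / **`chain_left`**.

Everything is PROVED; no definitions, no named facts.

## Sources

* G. Benfatto, A. Giuliani, V. Mastropietro, Ann. Henri Poincaré 7 (2006) 809–898, Lemma 3.1 / App. A2–A3. [BenfattoGiulianiMastropietro2006]
* V. Mastropietro, *Non-Perturbative Renormalization* (World Scientific, 2008), ch. 14, (14.67) p. 223; p. 229. [Mastropietro2008]
-/

noncomputable section

open Real Set

namespace Literature.MathematicalPhysics.QuantumLattice.BandSectorCounting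

/-! ## Calculus on the convex window -/

/-- Slope growth under `g″ ≥ c₂` on `[x, y]`: `c₂ (t − s) ≤ g′ t − g′ s` for `x ≤ s ≤ t ≤ y`. [folklore] -/
private theorem slope_growth {g' g'' : ℝ → ℝ} (hg' : ∀ z, HasDerivAt g' (g'' z) z) {x y c₂ : ℝ}
    (h : ∀ z ∈ Icc x y, c₂ ≤ g'' z) {s t : ℝ} (hs : x ≤ s) (hst : s ≤ t) (ht : t ≤ y) : c₂ * (t - s) ≤ g' t - g' s := by
  have hd' : ∀ z, HasDerivAt g' (deriv g' z) z := fun z => by rw [(hg' z).deriv]; exact hg' z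
  exact (convex_Icc x y).mul_sub_le_image_sub_of_le_deriv
    (fun t _ => (hd' t).continuousAt.continuousWithinAt)
    (fun t _ => (hd' t).differentiableAt.differentiableWithinAt)
    (fun t ht => by rw [(hg' t).deriv]; exact h t (interior_subset ht)) s ⟨hs, hst.trans ht⟩ t ⟨hs.trans hst, ht⟩ hst

/-- Monotone increase of `g` on `[s, t]` when `m ≤ g′` there: `m (t − s) ≤ g t − g s`. [folklore] -/
private theorem growth_of_deriv_ge {g g' : ℝ → ℝ} (hg : ∀ z, HasDerivAt g (g' z) z) {s t m : ℝ} (hst : s ≤ t)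
    (h : ∀ z ∈ Icc s t, m ≤ g' z) : m * (t - s) ≤ g t - g s := by
  have hd : ∀ z, HasDerivAt g (deriv g z) z := fun z => by rw [(hg z).deriv]; exact hg z
  exact (convex_Icc s t).mul_sub_le_image_sub_of_le_deriv
    (fun z _ => (hd z).continuousAt.continuousWithinAt)
    (fun z _ => (hd z).differentiableAt.differentiableWithinAt)
    (fun z hz => by rw [(hg z).deriv]; exact h z (interior_subset hz)) s (left_mem_Icc.2 hst) t (right_mem_Icc.2 hst) hst

/-- Monotone decrease: `g′ ≤ M` on `[s, t]` ⇒ `g t − g s ≤ M (t − s)`. [folklore] -/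
private theorem growth_of_deriv_le {g g' : ℝ → ℝ} (hg : ∀ z, HasDerivAt g (g' z) z) {s t M : ℝ} (hst : s ≤ t)
    (h : ∀ z ∈ Icc s t, g' z ≤ M) : g t - g s ≤ M * (t - s) := by
  have hd : ∀ z, HasDerivAt g (deriv g z) z := fun z => by rw [(hg z).deriv]; exact hg z
  exact (convex_Icc s t).image_sub_le_mul_sub_of_deriv_le
    (fun z _ => (hd z).continuousAt.continuousWithinAt)
    (fun z _ => (hd z).differentiableAt.differentiableWithinAt)
    (fun z hz => by rw [(hg z).deriv]; exact h z (interior_subset hz)) s (left_mem_Icc.2 hst) t (right_mem_Icc.2 hst) hst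

section Window

variable {g g' g'' : ℝ → ℝ} (hg : ∀ z, HasDerivAt g (g' z) z) (hg' : ∀ z, HasDerivAt g' (g'' z) z)
  {σc R c₂ : ℝ} (hc₂ : 0 < c₂) (hlo : ∀ z ∈ Icc (σc - R) (σc + R), c₂ ≤ g'' z) (hcrit : g' σc = 0)
include hg hg' hc₂ hlo hcrit

/-- Distance from the minimum of a non-positive window point: `g x ≤ 0` ⇒ `(x − σ_c)² ≤ 2|g σ_c|/c₂`.
[cite: BenfattoGiulianiMastropietro2006, Lemma 3.1 / App. A2] -/
theorem sq_sub_le_of_nonpos_near_min {x : ℝ} (hx : x ∈ Icc (σc - R) (σc + R)) (hgx : g x ≤ 0) :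
    (x - σc) ^ 2 ≤ 2 * (-g σc) / c₂ := by
  have h := le_of_critical hg hg' hlo hcrit hx
  rw [le_div_iff₀ hc₂]; nlinarith

/-- **Tangent (convexity) slope bound on the right**: for a window point `x > σ_c` with `g σ_c/2 < g x ≤ 0`, `√(c₂·|g σ_c|/8) ≤ g′ x`.
[cite: BenfattoGiulianiMastropietro2006, Lemma 3.1 / App. A2] -/
theorem deriv_ge_of_shallow_right {x : ℝ} (hx : x ∈ Icc (σc - R) (σc + R)) (hxσ : σc < x) (hgx : g x ≤ 0)
    (hsh : g σc / 2 < g x) : Real.sqrt (c₂ * (-g σc) / 8) ≤ g' x := by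
  -- tangent inequality at `x` evaluated at `σ_c`: `g σc ≥ g x + g' x (σc − x)` via the mean value bound with `g' ≤ g' x` on `[σc, x]`
  have hmono : ∀ z ∈ Icc σc x, g' z ≤ g' x := by
    intro z hz
    have := slope_growth hg' hlo (s := z) (t := x) (by linarith [hz.1, hx.1, hx.2]) hz.2 hx.2
    nlinarith [hz.2]
  have hgr := growth_of_deriv_le hg hxσ.le hmono
  -- so `g' x (x − σc) ≥ g x − g σc > |g σc|/2`
  have hDneg : g σc < 0 := by linarith
  have hpos : 0 < x - σc := sub_pos.2 hxσ
  have h1 : -g σc / 2 < g' x * (x - σc) := by linarith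
  have hsq := sq_sub_le_of_nonpos_near_min hg hg' hc₂ hlo hcrit hx hgx
  -- `g' x ≥ |g σc|/(2(x−σc))` and `(x−σc) ≤ √(2|gσc|/c₂)` ⇒ `g' x ≥ √(c₂|gσc|/8)`
  have hg'pos : 0 < g' x := by
    by_contra hle; push Not at hle
    have : g' x * (x - σc) ≤ 0 := mul_nonpos_of_nonpos_of_nonneg hle hpos.le
    linarith
  have h2 : (Real.sqrt (c₂ * (-g σc) / 8)) ^ 2 ≤ (g' x) ^ 2 := by
    rw [Real.sq_sqrt (by nlinarith)]
    -- `g'² (x−σc)² ≥ gσc²/4` and `(x−σc)² ≤ 2|gσc|/c₂`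
    have h3 : (-g σc / 2) ^ 2 ≤ (g' x * (x - σc)) ^ 2 := by
      have h0 : 0 ≤ -g σc / 2 := by linarith
      nlinarith [h1, h0]
    have h4 : (g' x * (x - σc)) ^ 2 = (g' x) ^ 2 * (x - σc) ^ 2 := by ring
    rw [h4] at h3
    have h5 : (g' x) ^ 2 * (x - σc) ^ 2 ≤ (g' x) ^ 2 * (2 * (-g σc) / c₂) := mul_le_mul_of_nonneg_left hsq (sq_nonneg _)
    have h6 : (-g σc / 2) ^ 2 ≤ (g' x) ^ 2 * (2 * (-g σc) / c₂) := h3.trans h5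
    rw [mul_div_assoc'] at h6
    rw [le_div_iff₀ hc₂] at h6
    have hD0 : 0 < -g σc := by linarith
    nlinarith [h6, hD0]
  nlinarith [h2, Real.sqrt_nonneg (c₂ * (-g σc) / 8), hg'pos]

/-- **Tangent slope bound on the left**: for a window point `x < σ_c` with `g σ_c/2 < g x ≤ 0`, `g′ x ≤ −√(c₂·|g σ_c|/8)`.
[cite: BenfattoGiulianiMastropietro2006, Lemma 3.1 / App. A2] -/
theorem deriv_le_of_shallow_left {x : ℝ} (hx : x ∈ Icc (σc - R) (σc + R)) (hxσ : x < σc) (hgx : g x ≤ 0)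
    (hsh : g σc / 2 < g x) : g' x ≤ -Real.sqrt (c₂ * (-g σc) / 8) := by
  have hmono : ∀ z ∈ Icc x σc, g' x ≤ g' z := by
    intro z hz
    have := slope_growth hg' hlo (s := x) (t := z) hx.1 hz.1 (by linarith [hz.2, hx.1, hx.2])
    nlinarith [hz.1]
  have hgr := growth_of_deriv_ge hg hxσ.le hmono
  have hDneg : g σc < 0 := by linarith
  have hpos : 0 < σc - x := sub_pos.2 hxσ
  have h1 : -g σc / 2 < -g' x * (σc - x) := by linarith
  have hsq := sq_sub_le_of_nonpos_near_min hg hg' hc₂ hlo hcrit hx hgx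
  have hg'neg : 0 < -g' x := by
    by_contra hle; push Not at hle
    have : -g' x * (σc - x) ≤ 0 := mul_nonpos_of_nonpos_of_nonneg hle hpos.le
    linarith
  have h2 : (Real.sqrt (c₂ * (-g σc) / 8)) ^ 2 ≤ (-g' x) ^ 2 := by
    rw [Real.sq_sqrt (by nlinarith)]
    have h3 : (-g σc / 2) ^ 2 ≤ (-g' x * (σc - x)) ^ 2 := by
      have h0 : 0 ≤ -g σc / 2 := by linarith
      nlinarith [h1, h0]
    have h4 : (-g' x * (σc - x)) ^ 2 = (-g' x) ^ 2 * (x - σc) ^ 2 := by ring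
    rw [h4] at h3
    have h5 : (-g' x) ^ 2 * (x - σc) ^ 2 ≤ (-g' x) ^ 2 * (2 * (-g σc) / c₂) := mul_le_mul_of_nonneg_left hsq (sq_nonneg _)
    have h6 : (-g σc / 2) ^ 2 ≤ (-g' x) ^ 2 * (2 * (-g σc) / c₂) := h3.trans h5
    rw [mul_div_assoc'] at h6
    rw [le_div_iff₀ hc₂] at h6
    have hD0 : 0 < -g σc := by linarith
    nlinarith [h6, hD0]
  nlinarith [h2, Real.sqrt_nonneg (c₂ * (-g σc) / 8), hg'neg]

/-- `g` is increasing on the right half-window: `σ_c ≤ s ≤ t ≤ σ_c + R` ⇒ `g s ≤ g t`.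
[cite: BenfattoGiulianiMastropietro2006, Lemma 3.1 / App. A2] -/
theorem mono_right_of_min {s t : ℝ} (hs : σc ≤ s) (hst : s ≤ t) (ht : t ≤ σc + R) : g s ≤ g t := by
  have h : ∀ z ∈ Icc s t, 0 ≤ g' z := by
    intro z hz
    have := slope_growth hg' hlo (s := σc) (t := z) (by linarith [hz.1, hz.2]) (hs.trans hz.1) (hz.2.trans ht)
    rw [hcrit] at this; nlinarith [hz.1]
  have := growth_of_deriv_ge hg hst h
  nlinarith

/-- `g` is decreasing on the left half-window: `σ_c − R ≤ s ≤ t ≤ σ_c` ⇒ `g t ≤ g s`.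
[cite: BenfattoGiulianiMastropietro2006, Lemma 3.1 / App. A2] -/
theorem anti_left_of_min {s t : ℝ} (hs : σc - R ≤ s) (hst : s ≤ t) (ht : t ≤ σc) : g t ≤ g s := by
  have h : ∀ z ∈ Icc s t, g' z ≤ 0 := by
    intro z hz
    have := slope_growth hg' hlo (s := z) (t := σc) (hs.trans hz.1) (hz.2.trans ht) (by linarith [hz.1, hz.2])
    rw [hcrit] at this; nlinarith [hz.2]
  have := growth_of_deriv_le hg hst h
  nlinarith

/-- **Chain growth on the right**: two shallow negative window points `σ_c < s ≤ t` (`g σ_c/2 < g s`, `g t ≤ 0`) satisfy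
`|g s| ≥ |g t| + v (t − s)`, `v = √(c₂|g σ_c|/8)`. [cite: BenfattoGiulianiMastropietro2006, Lemma 3.1 / App. A2] -/
theorem chain_right {s t : ℝ} (hs : σc < s) (hst : s ≤ t) (ht : t ≤ σc + R) (hgs : g σc / 2 < g s) (hgt : g t ≤ 0) :
    Real.sqrt (c₂ * (-g σc) / 8) * (t - s) ≤ g t - g s := by
  refine growth_of_deriv_ge hg hst fun z hz => ?_
  have hz1 : z ∈ Icc (σc - R) (σc + R) := ⟨by linarith [hz.1, hst, ht], hz.2.trans ht⟩
  have hgz0 : g z ≤ 0 := (mono_right_of_min hg hg' hc₂ hlo hcrit (hs.le.trans hz.1) hz.2 ht).trans hgt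
  have hgz : g σc / 2 < g z := lt_of_lt_of_le hgs (mono_right_of_min hg hg' hc₂ hlo hcrit hs.le hz.1 (hz.2.trans ht))
  exact deriv_ge_of_shallow_right hg hg' hc₂ hlo hcrit hz1 (hs.trans_le hz.1) hgz0 hgz

/-- **Chain growth on the left**: `σ_c − R ≤ s ≤ t < σ_c`, `g s ≤ 0`, `g σ_c/2 < g t` ⇒ `v (t − s) ≤ g s − g t`.
[cite: BenfattoGiulianiMastropietro2006, Lemma 3.1 / App. A2] -/
theorem chain_left {s t : ℝ} (hs : σc - R ≤ s) (hst : s ≤ t) (ht : t < σc) (hgs : g s ≤ 0) (hgt : g σc / 2 < g t) :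
    Real.sqrt (c₂ * (-g σc) / 8) * (t - s) ≤ g s - g t := by
  have h := growth_of_deriv_le hg hst (M := -Real.sqrt (c₂ * (-g σc) / 8)) fun z hz => ?_
  · linarith
  have hz1 : z ∈ Icc (σc - R) (σc + R) := ⟨hs.trans hz.1, by linarith [hz.2, ht]⟩
  have hgz0 : g z ≤ 0 := (anti_left_of_min hg hg' hc₂ hlo hcrit hs hz.1 (hz.2.trans ht.le)).trans hgs
  have hgz : g σc / 2 < g z := lt_of_lt_of_le hgt (anti_left_of_min hg hg' hc₂ hlo hcrit (hs.trans hz.1) hz.2 ht.le)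
  exact deriv_le_of_shallow_left hg hg' hc₂ hlo hcrit hz1 (lt_of_le_of_lt hz.2 ht) hgz0 hgz

end Window

end Literature.MathematicalPhysics.QuantumLattice.BandSectorCounting

end
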